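import Mathlib
import Literature.Barriers.PneNP.TSPExtensionComplexityFaces
import Literature.Computability.AlgebraicComplexity.NestFreeMatchingPoly
import Summits.ValiantsHypothesis.ValiantsHypothesis.Theorems.FifoMatchingNNLinearDegreeCofactorHardAvoidingMatchings
import Summits.ValiantsHypothesis.ValiantsHypothesis.Theorems.FifoMatchingNNDivisionHardPrescribedInternalFace
import HarnessLib

/-!
# NEXT-RUNG (dual lens) — the polyhedral currency for HIGH-DEGREE cofactors of `NN_n`

Workfile of val-idea-7 g5 (LENS dual) for crux `NNLinearDegreeCofactorHard` (stmt-23918) / the rung above it,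
`NNDivisionHard` (stmt-21181: cofactors `h` of ARBITRARY degree).  Companion memo:
`Cruxes/NNLinearDegreeCofactorHard/Lines/internal_cofactor-NEXT-RUNG-dual.md`.

The lever is i1's («queue-grid-xc», crit-3 #8 PASS-WITH-PRICE): over `ℝ≥0` there is no cancellation, so
`supp(NN_n · h) = supp(NN_n) + supp(h)` and `Newt(NN_n · h) = NFP(2n) + Newt(h)` (Minkowski sum), and a monotone
circuit of size `s` gives an extended formulation of the Newton polytope of size `O(s)` (`MonotoneCircuitEF`, i1's P1,
UNPROVED in tree; formula case = Hrubeš–Yehudayoff 2021 Thm 35).  What this file adds (val-idea-7): extension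
complexity is TRANSLATION-INVARIANT (`hasEFOfSize_add_singleton`, proved), hence the MONOMIAL rung of the
high-degree cofactor problem — "is `L₊(NN_n · x^e) ≥ 2^{polylog}` for every exponent `e`, however large?" (HD-1), which
is NOT formal for monotone complexity (monomial division costs `5^{|e|}`) — is FREE in xc-currency:
`hd1_of_xc : MonotoneCircuitEF → NFPolytopeQuasiPolyXC → NNMonomialCofactorHard` (kernel-checked below, no sorry),
and `hd1_of_xc_qp`, the same from the quasi-polynomial circuit-to-EF bound `MonotoneCircuitQuasiPolyEF`, which is IN
PRINT (Grochow 2017, arXiv:1510.08417, Lemma 3.1 + Prop 4.5 + Cor 4.6) — so only K1 (`NFPolytopeQuasiPolyXC`) is open.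
More generally every cofactor with an exposed SINGLETON class modulo the matching lattice is free (memo §3, faces of a
Minkowski sum); the residual = lattice-homogeneous "matching-like" cofactors on ≥ n of the 2n positions (memo §4).
In MONOTONE currency the matching move is to PRESCRIBE the internal part of the matchings (last section:
`prescribedFamilyPoly`, `stub_prescribedInternalFace` — a typed, sorried reduction target generalising the tree's
`KillCofactor` from `S = ∅` to any realizable `S`; it WAS the only `sorry` of this file — POSTSCRIPT (val-width-23918-c1 g3,
2026-08-28, memo R1 / tenure g11 disposition (i)): now PROVED BY NAME from the landed helper
`Theorems/FifoMatchingNNDivisionHardPrescribedInternalFace.lean` (`…NNDivisionHard.PrescribedInternal.complexity_prescribedFamily_mul_C_le`,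
`--supports` stmt-21181); this file is sorry-free and still concludes no route item).
[wiring note, c1 g3: the unused direct `import …Theses.FifoMatching` of @46c477a09103 was dropped — no decl of
this file mentions the route file (it concludes no route item), and the import only tied the workfile to the route cone's
build state; everything else is val-idea-7 g5's text verbatim.]
Nothing here is a theorem about `L₊` unconditionally: both xc hypotheses are open (i1 K1 at `R = ∅`, P1).  VP ≠ VNP is
not moved by anything in this file.
-/

namespace Summit.ValiantsHypothesis.ValiantsHypothesis.Cruxes.NNLinearDegreeCofactorHard.NextRungDual

open Matrix MvPolynomial Literature.Computability.AlgebraicComplexity Literature.Barriers.PneNP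
open scoped NNReal Pointwise

variable {σ : Type}

/-- the exponent vector `d` as a real point -/
def realOf (d : σ →₀ ℕ) : σ → ℝ := fun i => ((d i : ℕ) : ℝ)

theorem realOf_add (d e : σ →₀ ℕ) : realOf (d + e) = realOf d + realOf e := by
  funext i; simp [realOf, Finsupp.add_apply, Nat.cast_add]

/-- the exponent vectors of `f`, as real points -/
def suppPts (f : MvPolynomial σ ℝ≥0) : Set (σ → ℝ) := realOf '' (f.support : Set (σ →₀ ℕ))

/-- the Newton polytope `Newt(f) = conv(supp f)` -/
def newt (f : MvPolynomial σ ℝ≥0) : Set (σ → ℝ) := convexHull ℝ (suppPts f)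

/-- **P1** (i1 «queue-grid-xc»; UNPROVED in tree — flow-LP re-derivation accepted by crit-3 #8; the FORMULA case is
Hrubeš–Yehudayoff, *Shadows of Newton polytopes*, CCC 2021, Thm 35): a monotone (= `ℝ≥0`) fan-in-two circuit of size
`s` for `f ≠ 0` yields an extended formulation of `Newt(f)` with at most `C·s + C` inequalities. -/
def MonotoneCircuitEF : Prop :=
  ∃ C : ℕ, ∀ (m : ℕ) (f : MvPolynomial (Fin m × Fin m) ℝ≥0), f ≠ 0 →
    HasEFOfSize (newt f) (C * complexity f + C)

/-- **P1′ — the quasi-polynomial form, which is IN PRINT** (Grochow, *Monotone projection lower bounds from extended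
formulation lower bounds*, ToC 13 (2017) art. 18 = arXiv:1510.08417: Lemma 3.1 (a monotone projection `f ≤ g` makes a
face of `Newt g` an extension of `Newt f`) + Prop. 4.5 (a monotone formula of size `s` is a monotone projection of
`perm_{s+1}`, whose Newton polytope — the cycle-cover polytope — has `(s+1)²` facets) + the proof of Cor. 4.6 (monotone
circuits balance à la VSBR into monotone formulas of size `2^{O(log² s)}`); NOT formalised here, stated `∃ C`-weakly:
`xc(Newt f) ≤ 2^((log₂ L₊(f) + C)^C)`).  For thresholds of the shape `∀ c, 2^((log₂ n + c)^c)` this loses NOTHING: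
`hd1_of_xc_qp`.  So of the two inputs of the xc programme only K1 (`NFPolytopeQuasiPolyXC`) is open. -/
def MonotoneCircuitQuasiPolyEF : Prop :=
  ∃ C : ℕ, ∀ (m : ℕ) (f : MvPolynomial (Fin m × Fin m) ℝ≥0), f ≠ 0 →
    HasEFOfSize (newt f) (2 ^ ((Nat.log 2 (complexity f) + C) ^ C))

/-- **NFP-xc** (i1's K1 at `R = ∅`, quasi-polynomial form; UNPROVED): every extended formulation of the nest-free
perfect matching polytope `NFP(2n) = Newt(NN_n)` has more than `2^((log₂ n + c)^c)` inequalities, for every `c`,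
eventually in `n`. -/
def NFPolytopeQuasiPolyXC : Prop :=
  ∀ c : ℕ, ∃ n₀ : ℕ, ∀ n ≥ n₀, ∀ r : ℕ,
    HasEFOfSize (newt (nestFreeMatchingPoly n ℝ≥0)) r → 2 ^ ((Nat.log 2 n + c) ^ c) < r

/-- **HD-1** (the monomial rung of `NNDivisionHard` beyond `NNLinearDegreeCofactorHard`): monomial cofactors of
ARBITRARY degree do not help `NN_n` in the monotone world. -/
def NNMonomialCofactorHard : Prop :=
  ∀ c : ℕ, ∃ n₀ : ℕ, ∀ n ≥ n₀, ∀ e : (Fin (2 * n) × Fin (2 * n)) →₀ ℕ,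
    2 ^ ((Nat.log 2 n + c) ^ c) < complexity (nestFreeMatchingPoly n ℝ≥0 * monomial e 1)

/-! ## Translation invariance of extension complexity (proved) -/

/-- Translating a set does not change the size of its extended formulations. [folklore] -/
theorem hasEFOfSize_add_singleton {ι : Type} [Fintype ι] {P : Set (ι → ℝ)} {r : ℕ}
    (h : HasEFOfSize P r) (v : ι → ℝ) : HasEFOfSize (P + {v}) r := by
  obtain ⟨Q, hQ⟩ := h
  refine ⟨⟨Q.k, Q.E, Q.F, Q.g + Q.E.mulVec v⟩, ?_⟩
  ext x
  simp only [ExtendedFormulation.projSet, Set.mem_setOf_eq, Set.add_singleton, Set.mem_image, ← hQ]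
  constructor
  · rintro ⟨y, hy, hE⟩
    refine ⟨x - v, ⟨y, hy, ?_⟩, sub_add_cancel x v⟩
    rw [Matrix.mulVec_sub]
    have : Q.E *ᵥ x + Q.F *ᵥ y - Q.E *ᵥ v = Q.g := by rw [hE]; abel
    rw [← this]; abel
  · rintro ⟨z, ⟨y, hy, hE⟩, rfl⟩
    refine ⟨y, hy, ?_⟩
    rw [Matrix.mulVec_add, ← hE]; abel

/-! ## Newton polytope of a monomial multiple = translate (proved) -/

theorem support_mul_monomial_one (f : MvPolynomial σ ℝ≥0) (e : σ →₀ ℕ) :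
    (f * monomial e 1).support = f.support.map (addRightEmbedding e) := by
  classical
  exact AddMonoidAlgebra.support_coeff_mul_single f _ (by simp) _

theorem suppPts_mul_monomial (f : MvPolynomial σ ℝ≥0) (e : σ →₀ ℕ) :
    suppPts (f * monomial e 1) = suppPts f + {realOf e} := by
  classical
  ext x
  simp only [suppPts, support_mul_monomial_one, Finset.coe_map, Set.add_singleton, Set.mem_image,
    Finset.mem_coe, addRightEmbedding_apply]
  constructor
  · rintro ⟨d', ⟨d, hd, rfl⟩, rfl⟩
    exact ⟨realOf d, ⟨d, hd, rfl⟩, (realOf_add d e).symm⟩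
  · rintro ⟨y, ⟨d, hd, rfl⟩, rfl⟩
    exact ⟨d + e, ⟨d, hd, rfl⟩, realOf_add d e⟩

theorem newt_mul_monomial (f : MvPolynomial σ ℝ≥0) (e : σ →₀ ℕ) :
    newt (f * monomial e 1) = newt f + {realOf e} := by
  rw [newt, suppPts_mul_monomial, convexHull_add, convexHull_singleton, newt]

/-- `NN_n ≠ 0`: the nest-free perfect matchings of `[2n]` are nonempty (`exists_nestFree_avoiding ∅`). -/
theorem nn_ne_zero (n : ℕ) : nestFreeMatchingPoly n ℝ≥0 ≠ 0 := by
  classical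
  obtain ⟨M, hM, -⟩ :=
    Summit.ValiantsHypothesis.ValiantsHypothesis.Theorems.FifoMatching.NNLinearDegreeCofactorHard.AvoidingMatchings.exists_nestFree_avoiding
      (n := n) ∅ (by simp)
  intro h0
  have hmem : arcExponent M ∈ (nestFreeMatchingPoly n ℝ≥0).support := by
    rw [support_nestFreeMatchingPoly]
    exact Finset.mem_image_of_mem _ hM
  rw [h0, support_zero] at hmem
  simp at hmem

/-! ## HD-1 is free in xc-currency (proved modulo the two named open inputs) -/

/-- arithmetic: room between consecutive quasi-polynomial thresholds absorbs the constant of P1. -/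
theorem threshold_room (C c L : ℕ) (hC : 2 ≤ C) (hL : 2 ≤ L) :
    C * 2 ^ ((L + c) ^ c) + C ≤ 2 ^ ((L + (c + C)) ^ (c + C)) := by
  set A := (L + c) ^ c with hA
  have hx : 2 ≤ L + c := by omega
  -- (L + c + C)^(c+C) ≥ (L+c)^c * (L+c+C)^C ≥ A * 2^C
  have h1 : A * 2 ^ C ≤ (L + (c + C)) ^ (c + C) := by
    have e1 : (L + (c + C)) ^ (c + C) = (L + (c + C)) ^ c * (L + (c + C)) ^ C := by rw [pow_add]
    rw [e1]
    apply Nat.mul_le_mul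
    · exact Nat.pow_le_pow_left (by omega) c
    · exact Nat.pow_le_pow_left (by omega) C
  -- 2^C ≥ C + 2 for C ≥ 2
  have h2C : C + 2 ≤ 2 ^ C := by
    clear h1 hx hA hL A
    induction C, hC using Nat.le_induction with
    | base => norm_num
    | succ m hm ih => rw [pow_succ]; omega
  have hA1 : 1 ≤ A := Nat.one_le_pow _ _ (by omega)
  -- A * 2^C ≥ A + C + 1
  have h2 : A + C + 1 ≤ A * 2 ^ C := by
    calc A + C + 1 ≤ A + A * (C + 1) := by nlinarith
      _ = A * (C + 2) := by ring
      _ ≤ A * 2 ^ C := Nat.mul_le_mul_left A h2C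
  have h3 : A + C + 1 ≤ (L + (c + C)) ^ (c + C) := h2.trans h1
  -- C * 2^A + C ≤ 2^(A + C + 1)
  have hC2 : C ≤ 2 ^ C := (Nat.lt_two_pow_self).le
  calc C * 2 ^ A + C ≤ 2 ^ C * 2 ^ A + 2 ^ C * 2 ^ A := by
          have : C ≤ 2 ^ C * 2 ^ A := hC2.trans (Nat.le_mul_of_pos_right _ (Nat.two_pow_pos A))
          nlinarith [Nat.mul_le_mul_right (2 ^ A) hC2]
    _ = 2 ^ (A + C + 1) := by rw [pow_add, pow_add, pow_one]; ring
    _ ≤ 2 ^ ((L + (c + C)) ^ (c + C)) := Nat.pow_le_pow_right (by norm_num) h3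

/-- **HD-1 ⇐ P1 ∧ NFP-xc.**  Monomial cofactors of any degree are free in the polyhedral currency: `Newt(NN_n · x^e)`
is a translate of `NFP(2n)`, extension complexity is translation-invariant, so an EF bound for `NFP(2n)` is an `L₊`
bound for `NN_n · x^e` uniformly in `e`.  [folklore assembly; inputs: i1 P1, i1 K1(R = ∅)] -/
theorem hd1_of_xc (hP1 : MonotoneCircuitEF) (hK : NFPolytopeQuasiPolyXC) : NNMonomialCofactorHard := by
  classical
  obtain ⟨C₀, hC₀⟩ := hP1
  -- enlarge the constant to C ≥ 2
  set C := max C₀ 2 with hCdef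
  have hC2 : 2 ≤ C := le_max_right _ _
  have hP : ∀ (m : ℕ) (f : MvPolynomial (Fin m × Fin m) ℝ≥0), f ≠ 0 →
      HasEFOfSize (newt f) (C * complexity f + C) := by
    intro m f hf
    refine (hC₀ m f hf).of_le ?_
    have : C₀ ≤ C := le_max_left _ _
    exact Nat.add_le_add (Nat.mul_le_mul_right _ this) this
  intro c
  obtain ⟨n₀, hn₀⟩ := hK (c + C)
  refine ⟨max n₀ 4, fun n hn e => ?_⟩
  have hn₀' : n₀ ≤ n := (le_max_left _ _).trans hn
  have hn4 : 4 ≤ n := (le_max_right _ _).trans hn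
  have hL : 2 ≤ Nat.log 2 n := by
    have : Nat.log 2 4 = 2 := by decide
    rw [← this]; exact Nat.log_mono_right hn4
  set f := nestFreeMatchingPoly n ℝ≥0 * monomial e 1 with hf
  -- f ≠ 0 : NN_n ≠ 0 (it has the FIFO ladder matching as a monomial) and monomials are regular
  have hNN : nestFreeMatchingPoly n ℝ≥0 ≠ 0 := nn_ne_zero n
  have hf0 : f ≠ 0 := by
    intro h0
    apply hNN
    have := congrArg MvPolynomial.support h0
    rw [hf, support_mul_monomial_one, support_zero, Finset.map_eq_empty] at this
    exact support_eq_empty.mp this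
  -- EF of Newt(f) of size C·L₊(f) + C, hence of its translate Newt(NN_n) = Newt(f) + {-e}
  have hEF := hP (2 * n) f hf0
  have hnewt : newt f = newt (nestFreeMatchingPoly n ℝ≥0) + {realOf e} := by
    rw [hf]; exact newt_mul_monomial _ _
  have hEF' : HasEFOfSize (newt (nestFreeMatchingPoly n ℝ≥0)) (C * complexity f + C) := by
    have := hasEFOfSize_add_singleton hEF (-(realOf e))
    rwa [hnewt, add_assoc, Set.singleton_add_singleton, add_neg_cancel, Set.singleton_zero, add_zero] at this
  have hlt := hn₀ n hn₀' _ hEF'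
  -- 2^((L + c + C)^(c+C)) < C s + C  and  C 2^((L+c)^c) + C ≤ 2^((L+c+C)^(c+C))  ⇒  2^((L+c)^c) < s
  by_contra hle
  push_neg at hle
  have := threshold_room C c (Nat.log 2 n) hC2 hL
  have h' : C * complexity f + C ≤ C * 2 ^ ((Nat.log 2 n + c) ^ c) + C :=
    Nat.add_le_add_right (Nat.mul_le_mul_left C hle) C
  omega

/-- room in the quasi-polynomial thresholds: `((ℓ + c)^c + C)^C ≤ (ℓ + c')^{c'}` with `c' = (c+1)·C + C`. -/
theorem qp_room (C c ℓ : ℕ) (hC : 2 ≤ C) (hℓ : 1 ≤ ℓ) :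
    ((ℓ + c) ^ c + C) ^ C ≤ (ℓ + ((c + 1) * C + C)) ^ ((c + 1) * C + C) := by
  have hb : 1 ≤ ℓ + c := le_add_right hℓ
  have hp : 1 ≤ (ℓ + c) ^ c := Nat.one_le_pow _ _ hb
  have h1 : (ℓ + c) ^ c + C ≤ (ℓ + c + C) ^ (c + 1) := by
    calc (ℓ + c) ^ c + C ≤ (ℓ + c) ^ c * (ℓ + c) + C * (ℓ + c) ^ c := by nlinarith
      _ = (ℓ + c + C) * (ℓ + c) ^ c := by ring
      _ ≤ (ℓ + c + C) * (ℓ + c + C) ^ c := Nat.mul_le_mul_left _ (Nat.pow_le_pow_left (by omega) c)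
      _ = (ℓ + c + C) ^ (c + 1) := by ring
  calc ((ℓ + c) ^ c + C) ^ C ≤ ((ℓ + c + C) ^ (c + 1)) ^ C := Nat.pow_le_pow_left h1 C
    _ = (ℓ + c + C) ^ ((c + 1) * C) := by rw [← pow_mul]
    _ ≤ (ℓ + ((c + 1) * C + C)) ^ ((c + 1) * C) := Nat.pow_le_pow_left (by nlinarith) _
    _ ≤ (ℓ + ((c + 1) * C + C)) ^ ((c + 1) * C + C) := Nat.pow_le_pow_right (by omega) (by omega)

/-- **HD-1 ⇐ P1′ ∧ NFP-xc** — the same assembly from the PUBLISHED quasi-polynomial circuit-to-EF bound: the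
thresholds `∀ c, 2^((log₂ n + c)^c)` absorb the `2^{O(log²)}` loss (`qp_room`).  Conditional only on i1's K1 at
`R = ∅` and on a formalisation of Grochow's Lemma 3.1 / Prop 4.5 / monotone VSBR. [folklore assembly] -/
theorem hd1_of_xc_qp (hP1 : MonotoneCircuitQuasiPolyEF) (hK : NFPolytopeQuasiPolyXC) : NNMonomialCofactorHard := by
  classical
  obtain ⟨C₀, hC₀⟩ := hP1
  set C := max C₀ 2 with hCdef
  have hC2 : 2 ≤ C := le_max_right _ _
  have hP : ∀ (m : ℕ) (f : MvPolynomial (Fin m × Fin m) ℝ≥0), f ≠ 0 →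
      HasEFOfSize (newt f) (2 ^ ((Nat.log 2 (complexity f) + C) ^ C)) := by
    intro m f hf
    refine (hC₀ m f hf).of_le (Nat.pow_le_pow_right (by norm_num) ?_)
    have hC₀C : C₀ ≤ C := le_max_left _ _
    calc (Nat.log 2 (complexity f) + C₀) ^ C₀ ≤ (Nat.log 2 (complexity f) + C) ^ C₀ :=
          Nat.pow_le_pow_left (by omega) _
      _ ≤ (Nat.log 2 (complexity f) + C) ^ C := Nat.pow_le_pow_right (by omega) hC₀C
  intro c
  obtain ⟨n₀, hn₀⟩ := hK ((c + 1) * C + C)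
  refine ⟨max n₀ 2, fun n hn e => ?_⟩
  have hn₀' : n₀ ≤ n := (le_max_left _ _).trans hn
  have hn2 : 2 ≤ n := (le_max_right _ _).trans hn
  have hL : 1 ≤ Nat.log 2 n := by
    have : Nat.log 2 2 = 1 := by decide
    rw [← this]; exact Nat.log_mono_right hn2
  set f := nestFreeMatchingPoly n ℝ≥0 * monomial e 1 with hf
  have hNN : nestFreeMatchingPoly n ℝ≥0 ≠ 0 := nn_ne_zero n
  have hf0 : f ≠ 0 := by
    intro h0
    apply hNN
    have := congrArg MvPolynomial.support h0
    rw [hf, support_mul_monomial_one, support_zero, Finset.map_eq_empty] at this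
    exact support_eq_empty.mp this
  have hEF := hP (2 * n) f hf0
  have hnewt : newt f = newt (nestFreeMatchingPoly n ℝ≥0) + {realOf e} := by
    rw [hf]; exact newt_mul_monomial _ _
  have hEF' : HasEFOfSize (newt (nestFreeMatchingPoly n ℝ≥0)) (2 ^ ((Nat.log 2 (complexity f) + C) ^ C)) := by
    have := hasEFOfSize_add_singleton hEF (-(realOf e))
    rwa [hnewt, add_assoc, Set.singleton_add_singleton, add_neg_cancel, Set.singleton_zero, add_zero] at this
  by_contra hle
  push_neg at hle
  have hlog : Nat.log 2 (complexity f) ≤ (Nat.log 2 n + c) ^ c := by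
    have := Nat.log_mono_right (b := 2) hle
    rwa [Nat.log_pow (by norm_num : 1 < 2)] at this
  have hEF'' : HasEFOfSize (newt (nestFreeMatchingPoly n ℝ≥0))
      (2 ^ ((Nat.log 2 n + ((c + 1) * C + C)) ^ ((c + 1) * C + C))) := by
    refine hEF'.of_le (Nat.pow_le_pow_right (by norm_num) ?_)
    calc (Nat.log 2 (complexity f) + C) ^ C ≤ ((Nat.log 2 n + c) ^ c + C) ^ C :=
          Nat.pow_le_pow_left (by omega) _
      _ ≤ _ := qp_room C c (Nat.log 2 n) hC2 hL
  exact lt_irrefl _ (hn₀ n hn₀' _ hEF'')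

/-! ### Monotone currency: prescribing the internal part (unconditional reduction target, STUB)

`KillCofactor.complexity_family_mul_C_le` (tree, proved) removes an internal cofactor `p` on `R` in favour of the
AVOIDING family `𝓕_R = {M : no R-internal arc}` — which is EMPTY as soon as `|R| > n` and a single ladder for
`R = [1..n]`.  The same two free operations (top component for an `ℕ`-arc-weight, then `x_e ↦ 1` on `R × R`) with the
weight `W_S(e) = K·[e ∈ S] + [e external]`, `K > |S|`, expose instead the matchings whose internal arc set is EXACTLY a
prescribed realizable `S` (memo §3, Lemma N3): the prover CHOOSES the face.  `S = ∅` is the tree's case; `S ≠ ∅` is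
available for every `R` (no `|R| ≤ n`), e.g. `R = [1..n]`, `S` = the ladder on `[1..2k]` leaves the interleavings of
`P^{n-2k} U^{k}` — `2^{Ω(n)}` matchings — where `S = ∅` left one.  Stated here as a typed target only. -/

/-- the set of `R`-internal arcs `(i, M i)`, `i < M i`, `i, M i ∈ R`, of a matching `M` -/
def internalArcs {m : ℕ} (R : Finset (Fin m)) (M : Fin m → Fin m) : Finset (Fin m × Fin m) :=
  (Finset.univ.filter fun i : Fin m => i < M i ∧ i ∈ R ∧ M i ∈ R).image fun i => (i, M i)

/-- `AV_{R,S}`: the 0/1 polynomial of the nest-free perfect matchings of `[2n]` whose `R`-internal arc set is EXACTLY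
`S`, with those prescribed arcs erased (`S = ∅`: the avoiding family `𝓕_R` of `KillCofactor` / `AvoidingMatchings`). -/
noncomputable def prescribedFamilyPoly (n : ℕ) (R : Finset (Fin (2 * n)))
    (S : Finset (Fin (2 * n) × Fin (2 * n))) : MvPolynomial (Fin (2 * n) × Fin (2 * n)) ℝ≥0 :=
  ∑ M ∈ (nestFreeMatchings (2 * n)).filter (fun M => internalArcs R M = S),
    ∏ i : Fin (2 * n), if i < M i ∧ ¬ (i ∈ R ∧ M i ∈ R) then X (i, M i) else 1

/-- Former STUB, now a theorem BY NAME (helper `…Theorems.FifoMatching.NNDivisionHard.PrescribedInternal.complexity_prescribedFamily_mul_C_le`,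
val-width-23918-c1 g3; the `S = ∅` case is `complexity_family_mul_C_le`): **prescribing the internal
part**.  For `p ≠ 0` internal on `R` and ANY internal arc set `S` realised by a nest-free perfect matching,
`L₊(AV_{R,S} · β) ≤ L₊(NN_n · p)` for some `β ≠ 0`: top `W_S`-component (`W_S` as above; the top component of
`NN_n` is `Σ_{int M = S} x^M` because `K|int M ∩ S| + #ext M` is maximised exactly there once `K > |S|`; that of `p`
is a nonzero internal sub-polynomial `p'`), then `x_e ↦ 1` on `R × R` (`β = p'(1,…,1)`).  No hypothesis `|R| ≤ n`,
no degree hypothesis. [folklore tools; the prescribed-`S` use is this memo's] -/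
theorem stub_prescribedInternalFace (n : ℕ) (R : Finset (Fin (2 * n)))
    {p : MvPolynomial (Fin (2 * n) × Fin (2 * n)) ℝ≥0} (hp : p ≠ 0)
    (hint : ∀ d ∈ p.support, ∀ e ∈ d.support, e.1 ∈ R ∧ e.2 ∈ R)
    (S : Finset (Fin (2 * n) × Fin (2 * n))) (hS : ∃ M ∈ nestFreeMatchings (2 * n), internalArcs R M = S) :
    ∃ β : ℝ≥0, β ≠ 0 ∧
      complexity (prescribedFamilyPoly n R S * C β) ≤ complexity (nestFreeMatchingPoly n ℝ≥0 * p) :=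
  Summit.ValiantsHypothesis.ValiantsHypothesis.Theorems.FifoMatching.NNDivisionHard.PrescribedInternal.complexity_prescribedFamily_mul_C_le
    n R hp hint S hS

/-- the constant-free form (same helper file): `L₊(AV_{R,S}) ≤ L₊(NN_n · p) + 1`. [folklore] -/
theorem prescribedInternalFace_le_succ (n : ℕ) (R : Finset (Fin (2 * n)))
    {p : MvPolynomial (Fin (2 * n) × Fin (2 * n)) ℝ≥0} (hp : p ≠ 0)
    (hint : ∀ d ∈ p.support, ∀ e ∈ d.support, e.1 ∈ R ∧ e.2 ∈ R)
    (S : Finset (Fin (2 * n) × Fin (2 * n))) (hS : ∃ M ∈ nestFreeMatchings (2 * n), internalArcs R M = S) :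
    complexity (prescribedFamilyPoly n R S) ≤ complexity (nestFreeMatchingPoly n ℝ≥0 * p) + 1 :=
  Summit.ValiantsHypothesis.ValiantsHypothesis.Theorems.FifoMatching.NNDivisionHard.PrescribedInternal.complexity_prescribedFamily_le_succ
    n R hp hint S hS

end Summit.ValiantsHypothesis.ValiantsHypothesis.Cruxes.NNLinearDegreeCofactorHard.NextRungDual
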